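import Literature.IUT.HodgeTheaters.DiscreteProfiniteConjugates
import Mathlib.GroupTheory.OrderOfElement
import Mathlib.Algebra.Group.Conj
import HarnessLib

/-!
# [IUTchI] §2 plumbing: working inside the profinite completion `F̂` (components, coherent
# families, finite quotients, conjugacy, closures)

Mochizuki, *Inter-universal Teichmüller theory I*, §2, Theorem 2.6 / Remark 2.6.1 / Lemma 2.7 (v)–(vii)
(kurims May-2020 manuscript pp. 56–59) are statements about elements of the profinite completion `F̂`
of a discrete group: "Since `F` is residually finite …, we shall write `H, G ⊆ F ⊆ F̂`" (p. 56), "`Ĥ_G`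
for the closure of `H_G` in the profinite completion `Ĝ`" (p. 57), "`G` is conjugacy separable … it
follows that `γ · H_G · γ⁻¹ = ε · H_G · ε⁻¹`" (p. 57), "by projecting to `Ĝ^{ab}`" (p. 57).  The owner
file `DiscreteProfiniteConjugates.lean` (abc-iut-L5-t1) types `F̂` as Mathlib's
`profiniteCompletion F = ProfiniteGrp.ProfiniteCompletion.completion (GrpCat.of F)
 = ProfiniteGrp.limit (diagram (GrpCat.of F))` — the subgroup of `Π N, F ⧸ N` over ALL finite-index
normal subgroups `N : FiniteIndexNormalSubgroup F` cut out by the compatibilities — with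
`η = toCompletion F : F →* F̂` (dense image; injective iff `F` is residually finite,
`ProfiniteGrp.ProfiniteCompletion.mono_eta_iff_residuallyFinite`).

This file records the elementary PLUMBING over that construction which the dischargers of
Thm 2.6 / Lem 2.7 (v)–(vii) (abc-iut-L5-t9/t10/t11, L5-t14's conjugacy-separability input) and the
Rmk 2.6.1 witness (`ProfiniteConjugateWitness.lean`) need and Mathlib does not spell out; every item is
standard and carries the locator of the printed step it serves [cite: Mochizuki2012, Thm 2.6 p.56]
(D-0012 claim key, status disputed — the content here is plain profinite group theory and takes no side):

* components: `(η g).val N = g·N` (`toCompletion_val`), `(x⁻¹).val N = (x.val N)⁻¹` (`inv_val`; products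
  and `1` are Mathlib's `ProfiniteGrp.limit_mul_val` / `limit_one_val`), compatibility in coset form
  (`val_eq_mk_of_le`), continuity and surjectivity of `x ↦ x.val N` (`continuous_val`,
  `val_surjective`); the identity principle is Mathlib's `ProfiniteGrp.limit_ext`;
* construction of elements from a coherent family of representatives (`exists_val_eq_of_coherent`,
  `exists_val_eq_pow_of_modEq` — e.g. "`a^λ`, `λ ∈ Ẑ`");
* "`F ⊆ F̂` and finite quotients": every homomorphism `f : F → Q` to a finite group factors through `η`
  by the continuous homomorphism `x ↦ kerLift f (x.val (Ker f))` (`exists_lift_of_finite`);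
* "conjugacy separable ⇒ …": conjugacy in `F̂` descends to every finite quotient / finite image
  (`isConj_mk_of_isConj_toCompletion`, `isConj_apply_of_isConj_toCompletion`,
  `not_isConj_toCompletion_of_quotient`, `mk_conj_eq_of_conj_eq`);
* "the closure `Ĥ` of `H` in `Ĝ`": points of `closure (η '' S)` have all components in the image of `S`
  (`val_mem_image_of_mem_closure`, `val_mem_map_of_mem_closure`).
-/

namespace Literature.IUT.HodgeTheaters.ProfiniteCompletion

open CategoryTheory ProfiniteGrp ProfiniteGrp.ProfiniteCompletion Topology

universe u

variable {G : Type u} [Group G]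

/-! ### Components -/

/-- The `N`-th component of `η(g) ∈ Ĝ` is the coset `g·N ∈ G ⧸ N` (definitionally). [cite: Mochizuki2012, Thm 2.6 p.56] -/
theorem toCompletion_val (g : G) (N : FiniteIndexNormalSubgroup G) :
    (toCompletion G g).val N = (QuotientGroup.mk g : G ⧸ N.toSubgroup) :=
  rfl

/-- Components of inverses in `Ĝ` (companion of Mathlib's `ProfiniteGrp.limit_mul_val`,
`ProfiniteGrp.limit_one_val`). [cite: Mochizuki2012, Thm 2.6 p.56] -/
theorem inv_val (x : profiniteCompletion G) (N : FiniteIndexNormalSubgroup G) :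
    (x⁻¹).val N = (x.val N)⁻¹ :=
  rfl

/-- The compatibility condition carried by an element of `Ĝ`, in coset form: for `N ≤ M` the
`M`-th component is the image of the `N`-th one. [cite: Mochizuki2012, Thm 2.6 p.56] -/
theorem val_mk_eq_of_le (x : profiniteCompletion G) {N M : FiniteIndexNormalSubgroup G} (h : N ≤ M)
    (g : G) (hg : x.val N = (QuotientGroup.mk g : G ⧸ N.toSubgroup)) :
    x.val M = (QuotientGroup.mk g : G ⧸ M.toSubgroup) := by
  have hx := x.property (homOfLE h)
  rw [← hx]
  change (diagram (GrpCat.of G)).map (homOfLE h) (x.val N) = _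
  rw [hg]
  rfl

/-- Each projection `Ĝ → G ⧸ N`, `x ↦ x.val N`, is continuous (for the profinite topology on `Ĝ` and the
discrete topology on the finite quotient). [cite: Mochizuki2012, Thm 2.6 p.56] -/
theorem continuous_val (N : FiniteIndexNormalSubgroup G) :
    Continuous fun x : profiniteCompletion G => x.val N :=
  (continuous_apply N).comp continuous_subtype_val

/-- Each projection `Ĝ → G ⧸ N` is surjective: the coset `g·N` is the `N`-th component of `η(g)`.
[cite: Mochizuki2012, Thm 2.6 p.56] -/
theorem val_surjective (N : FiniteIndexNormalSubgroup G) :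
    Function.Surjective fun x : profiniteCompletion G => x.val N := by
  rintro ⟨g⟩
  exact ⟨toCompletion G g, rfl⟩

/-! ### Building elements of `Ĝ` from coherent families -/

/-- **Coherent families give elements of `Ĝ`.**  A family of representatives `g N ∈ G`, one for each
finite-index normal subgroup `N`, such that `g N ≡ g M (mod M)` whenever `N ≤ M`, defines an element
`x ∈ Ĝ` with `x.val N = g(N)·N` for all `N`. [cite: Mochizuki2012, Thm 2.6 p.56] -/
theorem exists_val_eq_of_coherent (g : FiniteIndexNormalSubgroup G → G)
    (hg : ∀ N M : FiniteIndexNormalSubgroup G, N ≤ M →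
      (QuotientGroup.mk (g N) : G ⧸ M.toSubgroup) = QuotientGroup.mk (g M)) :
    ∃ x : profiniteCompletion G,
      ∀ N : FiniteIndexNormalSubgroup G, x.val N = (QuotientGroup.mk (g N) : G ⧸ N.toSubgroup) :=
  ⟨⟨fun N => QuotientGroup.mk (g N), fun N M π => by
      change (QuotientGroup.mk (g N) : G ⧸ M.toSubgroup) = QuotientGroup.mk (g M)
      exact hg N M π.le⟩,
    fun _ => rfl⟩

/-- A convenient sufficient condition for coherence of a family of POWERS `a ^ k N` of one element:
the exponents are congruent modulo the index, `k N ≡ k M (mod [G : M])` for `N ≤ M`. [cite: Mochizuki2012, Thm 2.6 p.56] -/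
theorem exists_val_eq_pow_of_modEq (a : G) (k : FiniteIndexNormalSubgroup G → ℕ)
    (hk : ∀ N M : FiniteIndexNormalSubgroup G, N ≤ M → k N ≡ k M [MOD M.toSubgroup.index]) :
    ∃ x : profiniteCompletion G,
      ∀ N : FiniteIndexNormalSubgroup G, x.val N = (QuotientGroup.mk (a ^ k N) : G ⧸ N.toSubgroup) := by
  refine exists_val_eq_of_coherent (fun N => a ^ k N) fun N M h => ?_
  rw [QuotientGroup.mk_pow, QuotientGroup.mk_pow]
  exact pow_eq_pow_iff_modEq.mpr ((hk N M h).of_dvd (orderOf_dvd_natCard _))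

/-! ### Factoring homomorphisms to finite groups through `η` -/

/-- **Finite quotients factor through `Ĝ`.**  For a homomorphism `f : G → Q` with `Q` finite, the map
`f̂ : x ↦ kerLift f (x.val (Ker f))` is a continuous (for the discrete topology on `Q`) group homomorphism
`Ĝ → Q` with `f̂ ∘ η = f`; it is the unique continuous such map since `η(G)` is dense
(`ProfiniteCompletion.denseRange`).  Stated as an existence result with the defining formula.
[cite: Mochizuki2012, Thm 2.6 p.56] -/
theorem exists_lift_of_finite {Q : Type*} [Group Q] [Finite Q] (f : G →* Q) :
    ∃ fhat : profiniteCompletion G →* Q,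
      (∀ g : G, fhat (toCompletion G g) = f g) ∧
      (∀ x : profiniteCompletion G,
        fhat x = QuotientGroup.kerLift f (x.val (FiniteIndexNormalSubgroup.ofSubgroup f.ker))) ∧
      ∀ [TopologicalSpace Q] [DiscreteTopology Q], Continuous fhat := by
  let N : FiniteIndexNormalSubgroup G := FiniteIndexNormalSubgroup.ofSubgroup f.ker
  refine ⟨(QuotientGroup.kerLift f).comp (MonoidHom.mk' (fun x : profiniteCompletion G =>
      (x.val N : G ⧸ f.ker)) fun _ _ => rfl), fun g => ?_, fun x => rfl, ?_⟩
  · rfl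
  · intro _ _
    haveI : DiscreteTopology ((diagram (GrpCat.of G)).obj N) := ⟨rfl⟩
    have h1 : Continuous (fun y : (diagram (GrpCat.of G)).obj N => QuotientGroup.kerLift f y) :=
      continuous_of_discreteTopology
    exact h1.comp (continuous_val N)

/-! ### Conjugacy descends to finite quotients -/

/-- If `η u` and `η v` are conjugate in `Ĝ`, then `u·N` and `v·N` are conjugate in every finite quotient
`G ⧸ N`.  (Contrapositive: a finite quotient separating the conjugacy classes of `u` and `v` shows
`η u ≁ η v` — the form in which CONJUGACY SEPARABILITY of `G` is applied to `Ĝ`.) [cite: Mochizuki2012, Thm 2.6 p.56] -/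
theorem isConj_mk_of_isConj_toCompletion {u v : G}
    (h : IsConj (toCompletion G u) (toCompletion G v))
    (N : FiniteIndexNormalSubgroup G) :
    IsConj (QuotientGroup.mk u : G ⧸ N.toSubgroup) (QuotientGroup.mk v) :=
  (MonoidHom.mk' (fun x : profiniteCompletion G => (x.val N : G ⧸ N.toSubgroup))
    fun _ _ => rfl).map_isConj h

/-- If `η u` and `η v` are conjugate in `Ĝ`, then `f u` and `f v` are conjugate in `Q` for every
homomorphism `f : G → Q` to a finite group. [cite: Mochizuki2012, Thm 2.6 p.56] -/
theorem isConj_apply_of_isConj_toCompletion {Q : Type*} [Group Q] [Finite Q] (f : G →* Q) {u v : G}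
    (h : IsConj (toCompletion G u) (toCompletion G v)) :
    IsConj (f u) (f v) := by
  obtain ⟨fhat, hfhat, -, -⟩ := exists_lift_of_finite f
  rw [← hfhat u, ← hfhat v]
  exact fhat.map_isConj h

/-- Contrapositive packaging: if some finite-index normal subgroup `K ⊴ G` separates the conjugacy
classes of `u` and `v` (i.e. `u·K ≁ v·K` in `G ⧸ K`), then `η u` and `η v` are NOT conjugate in `Ĝ`.
[cite: Mochizuki2012, Thm 2.6 p.56] -/
theorem not_isConj_toCompletion_of_quotient {u v : G} (K : Subgroup G) [K.Normal] [K.FiniteIndex]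
    (h : ¬ IsConj (QuotientGroup.mk u : G ⧸ K) (QuotientGroup.mk v)) :
    ¬ IsConj (toCompletion G u) (toCompletion G v) :=
  fun hc => h (isConj_mk_of_isConj_toCompletion hc (FiniteIndexNormalSubgroup.ofSubgroup K))

/-- More generally, an element `γ ∈ Ĝ` conjugating `η u` to `η v` conjugates componentwise: for every
`N`, writing `γ.val N = c·N`, one has `c u c⁻¹ ≡ v (mod N)`. [cite: Mochizuki2012, Thm 2.6 p.56] -/
theorem mk_conj_eq_of_conj_eq {u v : G} (γ : profiniteCompletion G)
    (h : γ * toCompletion G u * γ⁻¹ = toCompletion G v)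
    (N : FiniteIndexNormalSubgroup G) (c : G) (hc : γ.val N = (QuotientGroup.mk c : G ⧸ N.toSubgroup)) :
    (QuotientGroup.mk (c * u * c⁻¹) : G ⧸ N.toSubgroup) = QuotientGroup.mk v := by
  -- the `N`-th projection as a homomorphism to the quotient group `G ⧸ N`
  let π : profiniteCompletion G →* G ⧸ N.toSubgroup :=
    MonoidHom.mk' (fun x => (x.val N : G ⧸ N.toSubgroup)) fun _ _ => rfl
  have hπ : π γ = QuotientGroup.mk c := hc
  have := congrArg π h
  rw [map_mul, map_mul, map_inv, hπ] at this
  change QuotientGroup.mk c * QuotientGroup.mk u * (QuotientGroup.mk c)⁻¹ = QuotientGroup.mk v at this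
  rwa [← QuotientGroup.mk_inv, ← QuotientGroup.mk_mul, ← QuotientGroup.mk_mul] at this

/-! ### Closures -/

/-- Points of the closure of `η(S)` in `Ĝ` have every component in the image of `S`: the projection
`Ĝ → G ⧸ N` is continuous into a discrete space, so the preimage of `S·N/N` is closed. [cite: Mochizuki2012, Thm 2.6 p.56] -/
theorem val_mem_image_of_mem_closure {S : Set G} {x : profiniteCompletion G}
    (hx : x ∈ closure (toCompletion G '' S)) (N : FiniteIndexNormalSubgroup G) :
    x.val N ∈ (QuotientGroup.mk : G → G ⧸ N.toSubgroup) '' S := by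
  -- the target `G ⧸ N` (as an object of the diagram) carries the discrete topology
  haveI : DiscreteTopology ((diagram (GrpCat.of G)).obj N) := ⟨rfl⟩
  have hclosed : IsClosed ((fun y : profiniteCompletion G => y.val N) ⁻¹'
      ((QuotientGroup.mk : G → G ⧸ N.toSubgroup) '' S)) :=
    (isClosed_discrete _).preimage (continuous_val N)
  have hsub : toCompletion G '' S ⊆
      (fun y : profiniteCompletion G => y.val N) ⁻¹' ((QuotientGroup.mk : G → G ⧸ N.toSubgroup) '' S) := by
    rintro _ ⟨s, hs, rfl⟩
    exact ⟨s, hs, rfl⟩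
  exact hclosed.closure_subset_iff.mpr hsub hx

/-- In particular a point of the closure of `η(H)`, `H ≤ G` a subgroup, has all its components in the
image subgroup `H·N/N`. [cite: Mochizuki2012, Thm 2.6 p.56] -/
theorem val_mem_map_of_mem_closure {H : Subgroup G} {x : profiniteCompletion G}
    (hx : x ∈ closure (toCompletion G '' (H : Set G))) (N : FiniteIndexNormalSubgroup G) :
    x.val N ∈ H.map (QuotientGroup.mk' N.toSubgroup) := by
  obtain ⟨s, hs, hsx⟩ := val_mem_image_of_mem_closure hx N
  exact ⟨s, hs, hsx⟩

end Literature.IUT.HodgeTheaters.ProfiniteCompletion
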